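import Summits.AtomisticToContinuum.HydrodynamicLimit.Theorems.LambertianContactSwapLambertianWellPosedCylinder

/-!
# The redraw on the one-particle torus phase space, and its lift to N particles

Helper file (`--supports`) of the support item `LambertianWellPosed` of route `LambertianContactSwap`
(`AtomisticToContinuum/HydrodynamicLimit`, stmt-AtomisticToContinuum-12101); part of the chain
HalfAngle → FluxLaw → Cylinder → PhaseLift → JInv proving that the Lambertian pre-kick of a pair preserves
`vol ⊗ γ` on the good pair data (the cosine law of the redraw). See the docstrings of the declarations.
-/

noncomputable section

open MeasureTheory ProbabilityTheory Set Function Filter Metric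
open scoped ENNReal InnerProductSpace Real

namespace Summit.AtomisticToContinuum.HydrodynamicLimit.Theorems

open Literature.MathematicalPhysics.KineticTheory Literature.Analysis.FluidPDE
  Literature.Analysis.FluidPDE.Alexander

open LWindow

namespace HalfAngle

/-! ## The redraw on the one-particle torus phase space -/

section Phase

/-- **The Lambertian redraw of the incoming direction preserves Haar × Lebesgue measure on the
good pair data of `T³ × ℝ³`** (chart form of `lintegral_billiardGood_redraw`): on the set of pair data
`(x, w)` whose lift `(reprSym x, w)` is billiard-good with hitting time `≤ δ` and speed `≤ R`
(`ε + δ R < 1/2`, so that everything stays in the chart), for measurable `g ≥ 0`,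
`∫ ∫ g(proj(n − τ₀ u'), u') dγ = ∫ g`. [folklore] -/
theorem lintegral_phase_redraw {ε δ R : ℝ} (hε : 0 < ε) (hδ : 0 ≤ δ) (hch : ε + δ * R < 1 / 2)
    {g : UnitAddTorus (Fin 3) × EuclideanSpace ℝ (Fin 3) → ℝ≥0∞} (hg : Measurable g) :
    ∫⁻ a in {a : UnitAddTorus (Fin 3) × EuclideanSpace ℝ (Fin 3) |
        liftPhase a ∈ (billiardGood ε : Set (EuclideanSpace ℝ (Fin 3) × EuclideanSpace ℝ (Fin 3))) ∧
        pairHitTime ε (liftPhase a).1 (liftPhase a).2 ≤ δ ∧ ‖a.2‖ ≤ R},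
      (∫⁻ ξ, g (projPhase (hitPoint ε (liftPhase a) - pairHitTime ε (liftPhase a).1 (liftPhase a).2 •
          (‖(liftPhase a).2‖ • (lambertDir (hitPoint ε (liftPhase a)) ξ - (2 * ⟪lambertDir (hitPoint ε (liftPhase a)) ξ, hitPoint ε (liftPhase a)⟫_ℝ / ‖hitPoint ε (liftPhase a)‖ ^ 2) • hitPoint ε (liftPhase a))),
        ‖(liftPhase a).2‖ • (lambertDir (hitPoint ε (liftPhase a)) ξ - (2 * ⟪lambertDir (hitPoint ε (liftPhase a)) ξ, hitPoint ε (liftPhase a)⟫_ℝ / ‖hitPoint ε (liftPhase a)‖ ^ 2) • hitPoint ε (liftPhase a))))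
          ∂(stdGaussian (EuclideanSpace ℝ (Fin 3)))) =
    ∫⁻ a in {a : UnitAddTorus (Fin 3) × EuclideanSpace ℝ (Fin 3) |
        liftPhase a ∈ (billiardGood ε : Set (EuclideanSpace ℝ (Fin 3) × EuclideanSpace ℝ (Fin 3))) ∧
        pairHitTime ε (liftPhase a).1 (liftPhase a).2 ≤ δ ∧ ‖a.2‖ ≤ R}, g a := by
  -- the redraw on the chart, made opaque
  obtain ⟨EL, hEL⟩ : ∃ EL : EuclideanSpace ℝ (Fin 3) → EuclideanSpace ℝ (Fin 3) × EuclideanSpace ℝ (Fin 3) →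
      EuclideanSpace ℝ (Fin 3) × EuclideanSpace ℝ (Fin 3), EL = fun ξ u =>
        (hitPoint ε u - pairHitTime ε u.1 u.2 • (‖u.2‖ • (lambertDir (hitPoint ε u) ξ - (2 * ⟪lambertDir (hitPoint ε u) ξ, hitPoint ε u⟫_ℝ / ‖hitPoint ε u‖ ^ 2) • hitPoint ε u)),
          ‖u.2‖ • (lambertDir (hitPoint ε u) ξ - (2 * ⟪lambertDir (hitPoint ε u) ξ, hitPoint ε u⟫_ℝ / ‖hitPoint ε u‖ ^ 2) • hitPoint ε u)) := ⟨_, rfl⟩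
  set bG : Set (EuclideanSpace ℝ (Fin 3) × EuclideanSpace ℝ (Fin 3)) := billiardGood ε with hbG
  have hbGm : MeasurableSet bG := measurableSet_billiardGood ε
  set C : Set (EuclideanSpace ℝ (Fin 3) × EuclideanSpace ℝ (Fin 3)) :=
    {u | pairHitTime ε u.1 u.2 ≤ δ ∧ ‖u.2‖ ≤ R} with hC
  have hCm : MeasurableSet C :=
    (measurableSet_le (measurable_pairHitTime ε) measurable_const).inter
      (measurableSet_le measurable_snd.norm measurable_const)
  set D₀ : Set (UnitAddTorus (Fin 3) × EuclideanSpace ℝ (Fin 3)) :=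
    {a | liftPhase a ∈ bG ∧ pairHitTime ε (liftPhase a).1 (liftPhase a).2 ≤ δ ∧ ‖a.2‖ ≤ R} with hD₀
  have hD₀ : D₀ = liftPhase ⁻¹' (bG ∩ C) := by
    ext a; simp only [hD₀, hC, mem_setOf_eq, mem_preimage, mem_inter_iff]; rfl
  have hD₀m : MeasurableSet D₀ := by rw [hD₀]; exact measurable_liftPhase (hbGm.inter hCm)
  -- good data lie in the chart
  have hchart : bG ∩ C ⊆ Torus.symCube (Fin 3) ×ˢ (univ : Set (EuclideanSpace ℝ (Fin 3))) := by
    rintro u ⟨hu, hτ, hw⟩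
    refine ⟨Torus.closedBall_subset_symCube hch (mem_closedBall_zero_iff.2 ?_), mem_univ _⟩
    have h1 : u.1 = hitPoint ε u - pairHitTime ε u.1 u.2 • u.2 := by simp [hitPoint]
    have hτ0 : 0 ≤ pairHitTime ε u.1 u.2 := (pairHitTime_pos hε.le hu.1 (PairHits.of_mem_billiardGood hu)).le
    calc ‖u.1‖ = ‖hitPoint ε u - pairHitTime ε u.1 u.2 • u.2‖ := by rw [← h1]
      _ ≤ ‖hitPoint ε u‖ + ‖pairHitTime ε u.1 u.2 • u.2‖ := norm_sub_le _ _
      _ ≤ ε + δ * R := by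
          rw [norm_hitPoint hε.le hu, norm_smul, Real.norm_of_nonneg hτ0]
          linarith [mul_le_mul hτ hw (norm_nonneg u.2) hδ]
  -- transfer an integral over `D₀` to the chart
  have transfer : ∀ {Φ : EuclideanSpace ℝ (Fin 3) × EuclideanSpace ℝ (Fin 3) → ℝ≥0∞}, Measurable Φ →
      ∫⁻ a in D₀, Φ (liftPhase a) = ∫⁻ u in bG, C.indicator Φ u := by
    intro Φ hΦ
    have h1 : ∫⁻ a in D₀, Φ (liftPhase a) = ∫⁻ a, ((bG ∩ C).indicator Φ) (liftPhase a) := by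
      rw [← lintegral_indicator hD₀m, hD₀]
      rfl
    rw [h1, ← lintegral_map (hΦ.indicator (hbGm.inter hCm)) measurable_liftPhase, map_liftPhase_volume,
      lintegral_indicator (hbGm.inter hCm), Measure.restrict_restrict (hbGm.inter hCm),
      inter_eq_left.2 hchart, lintegral_indicator hCm, Measure.restrict_restrict hCm, inter_comm]
  have hgp : Measurable fun u : EuclideanSpace ℝ (Fin 3) × EuclideanSpace ℝ (Fin 3) => g (projPhase u) :=
    hg.comp measurable_projPhase
  -- measurability of the redraw
  have hELm : Measurable fun p : (EuclideanSpace ℝ (Fin 3) × EuclideanSpace ℝ (Fin 3)) ×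
      EuclideanSpace ℝ (Fin 3) => EL p.2 p.1 := by
    rw [hEL]
    have hn : Measurable fun p : (EuclideanSpace ℝ (Fin 3) × EuclideanSpace ℝ (Fin 3)) ×
        EuclideanSpace ℝ (Fin 3) => hitPoint ε p.1 := (measurable_hitPoint ε).comp measurable_fst
    have hτ : Measurable fun p : (EuclideanSpace ℝ (Fin 3) × EuclideanSpace ℝ (Fin 3)) ×
        EuclideanSpace ℝ (Fin 3) => pairHitTime ε p.1.1 p.1.2 := (measurable_pairHitTime ε).comp measurable_fst
    have hd : Measurable fun p : (EuclideanSpace ℝ (Fin 3) × EuclideanSpace ℝ (Fin 3)) ×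
        EuclideanSpace ℝ (Fin 3) => lambertDir (hitPoint ε p.1) p.2 := hn.lambertDir measurable_snd
    have hu : Measurable fun p : (EuclideanSpace ℝ (Fin 3) × EuclideanSpace ℝ (Fin 3)) ×
        EuclideanSpace ℝ (Fin 3) => ‖p.1.2‖ • (lambertDir (hitPoint ε p.1) p.2 -
          (2 * ⟪lambertDir (hitPoint ε p.1) p.2, hitPoint ε p.1⟫_ℝ / ‖hitPoint ε p.1‖ ^ 2) • hitPoint ε p.1) :=
      (measurable_snd.comp measurable_fst).norm.smul (hd.sub (((measurable_const.mul (hd.inner hn)).div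
        (hn.norm.pow_const 2)).smul hn))
    exact (hn.sub (hτ.smul hu)).prodMk hu
  have hΦm : Measurable fun u : EuclideanSpace ℝ (Fin 3) × EuclideanSpace ℝ (Fin 3) =>
      ∫⁻ ξ, g (projPhase (EL ξ u)) ∂(stdGaussian (EuclideanSpace ℝ (Fin 3))) :=
    (hgp.comp hELm).lintegral_prod_right'
  -- rewrite both sides on the chart
  have hL : ∫⁻ a in D₀, (∫⁻ ξ, g (projPhase (EL ξ (liftPhase a))) ∂(stdGaussian (EuclideanSpace ℝ (Fin 3)))) =
      ∫⁻ u in bG, C.indicator (fun u => ∫⁻ ξ, g (projPhase (EL ξ u)) ∂(stdGaussian (EuclideanSpace ℝ (Fin 3)))) u :=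
    transfer hΦm
  have hR' : ∫⁻ a in D₀, g a = ∫⁻ u in bG, C.indicator (fun u => g (projPhase u)) u := by
    rw [← transfer hgp]
    simp only [projPhase_liftPhase]
  have hstmt : (fun a : UnitAddTorus (Fin 3) × EuclideanSpace ℝ (Fin 3) => ∫⁻ ξ, g (projPhase
      (hitPoint ε (liftPhase a) - pairHitTime ε (liftPhase a).1 (liftPhase a).2 •
        (‖(liftPhase a).2‖ • (lambertDir (hitPoint ε (liftPhase a)) ξ - (2 * ⟪lambertDir (hitPoint ε (liftPhase a)) ξ, hitPoint ε (liftPhase a)⟫_ℝ / ‖hitPoint ε (liftPhase a)‖ ^ 2) • hitPoint ε (liftPhase a))),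
        ‖(liftPhase a).2‖ • (lambertDir (hitPoint ε (liftPhase a)) ξ - (2 * ⟪lambertDir (hitPoint ε (liftPhase a)) ξ, hitPoint ε (liftPhase a)⟫_ℝ / ‖hitPoint ε (liftPhase a)‖ ^ 2) • hitPoint ε (liftPhase a))))
          ∂(stdGaussian (EuclideanSpace ℝ (Fin 3)))) =
      fun a => ∫⁻ ξ, g (projPhase (EL ξ (liftPhase a))) ∂(stdGaussian (EuclideanSpace ℝ (Fin 3))) := by
    rw [hEL]
  rw [hstmt, hL, hR']
  -- invariance of the cut-offs under the redraw, almost surely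
  have hinv : ∀ u ∈ bG, C.indicator (fun u => ∫⁻ ξ, g (projPhase (EL ξ u)) ∂(stdGaussian (EuclideanSpace ℝ (Fin 3)))) u =
      ∫⁻ ξ, C.indicator (fun u => g (projPhase u)) (EL ξ u) ∂(stdGaussian (EuclideanSpace ℝ (Fin 3))) := by
    intro u hu
    have hae : ∀ᵐ ξ ∂(stdGaussian (EuclideanSpace ℝ (Fin 3))), (EL ξ u ∈ C ↔ u ∈ C) := by
      filter_upwards [ae_stdGaussian_lambertDir_ne_zero_euclideanSpace (hitPoint ε u)] with ξ hξ
      obtain ⟨-, h2, h3, -⟩ := redraw_mem_billiardGood hε hu hξ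
      rw [hEL]
      simp only [hC, mem_setOf_eq]
      rw [h2, h3]
    by_cases huC : u ∈ C
    · rw [indicator_of_mem huC]
      refine lintegral_congr_ae ?_
      filter_upwards [hae] with ξ hξ
      rw [indicator_of_mem (hξ.2 huC)]
    · rw [indicator_of_notMem huC]
      refine (lintegral_congr_ae ?_).trans lintegral_zero |>.symm
      filter_upwards [hae] with ξ hξ
      rw [indicator_of_notMem (fun h => huC (hξ.1 h))]
  rw [setLIntegral_congr_fun hbGm hinv]
  -- the redraw invariance on the billiard good set
  have key := lintegral_billiardGood_redraw hε (hgp.indicator hCm)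
  rw [hEL]
  exact key

end Phase

/-! ## Lifting a one-coordinate redraw to the `N`-particle phase space -/

section Lift

variable {d : Type*} [Fintype d] {N : ℕ} {Ξ : Type*} [MeasurableSpace Ξ]

omit [Fintype d] in
/-- Updates at two distinct coordinates, read back. [folklore] -/
theorem update_update_apply {i j : Fin N} (hij : i ≠ j) (x : Config N d (UnitAddTorus d))
    (a b : UnitAddTorus d × EuclideanSpace ℝ d) :
    update (update x i a) j b i = a ∧ update (update x i a) j b j = b := by
  constructor
  · rw [update_of_ne hij, update_self]
  · rw [update_self]

/-- **Lifting a measure-preserving one-coordinate kernel** (Fubini along two coordinates): let the noisy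
map `a ↦ T ξ a` preserve Haar × Lebesgue measure on a measurable set `D₀` of one-particle data when the
noise `ξ` is integrated out (`∫_{D₀} ∫ g(T ξ a) dμ(ξ) da = ∫_{D₀} g`), and let `c ξ a` be any jointly
measurable translation. Then on `N` particles the map "redraw coordinate `i` by `T ξ`, translate
coordinate `j ≠ i` by `c ξ (z i)`" preserves volume on `{z | z i ∈ D₀}` in the same sense. [folklore] -/
theorem lintegral_lift_redraw (μ : Measure Ξ) [SFinite μ] {i j : Fin N} (hij : i ≠ j)
    {T c : Ξ → UnitAddTorus d × EuclideanSpace ℝ d → UnitAddTorus d × EuclideanSpace ℝ d}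
    (hT : Measurable fun p : Ξ × (UnitAddTorus d × EuclideanSpace ℝ d) => T p.1 p.2)
    (hc : Measurable fun p : Ξ × (UnitAddTorus d × EuclideanSpace ℝ d) => c p.1 p.2)
    {D₀ : Set (UnitAddTorus d × EuclideanSpace ℝ d)} (hD₀ : MeasurableSet D₀)
    (hinv : ∀ g : UnitAddTorus d × EuclideanSpace ℝ d → ℝ≥0∞, Measurable g →
      ∫⁻ a in D₀, (∫⁻ ξ, g (T ξ a) ∂μ) = ∫⁻ a in D₀, g a)
    {F : Config N d (UnitAddTorus d) → ℝ≥0∞} (hF : Measurable F) :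
    ∫⁻ z in {z | z i ∈ D₀}, (∫⁻ ξ, F (update (update z i (T ξ (z i))) j (z j + c ξ (z i))) ∂μ) =
      ∫⁻ z in {z | z i ∈ D₀}, F z := by
  haveI := isAddRightInvariant_volume_phase (d := d)
  haveI : SigmaFinite (volume : Measure (UnitAddTorus d × EuclideanSpace ℝ d)) := inferInstance
  have hDm : MeasurableSet {z : Config N d (UnitAddTorus d) | z i ∈ D₀} := (measurable_pi_apply i) hD₀
  -- the lifted map is jointly measurable
  have hJm : Measurable fun p : Config N d (UnitAddTorus d) × Ξ =>
      update (update p.1 i (T p.2 (p.1 i))) j (p.1 j + c p.2 (p.1 i)) := by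
    have h1 : Measurable fun p : Config N d (UnitAddTorus d) × Ξ => T p.2 (p.1 i) :=
      hT.comp (measurable_snd.prodMk ((measurable_pi_apply i).comp measurable_fst))
    have h2 : Measurable fun p : Config N d (UnitAddTorus d) × Ξ => p.1 j + c p.2 (p.1 i) :=
      ((measurable_pi_apply j).comp measurable_fst).add
        (hc.comp (measurable_snd.prodMk ((measurable_pi_apply i).comp measurable_fst)))
    have h3 : Measurable fun p : Config N d (UnitAddTorus d) × Ξ => update p.1 i (T p.2 (p.1 i)) :=
      measurable_update'.comp (measurable_fst.prodMk h1)
    exact measurable_update'.comp (h3.prodMk h2)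
  have hf₁ : Measurable fun z : Config N d (UnitAddTorus d) =>
      ∫⁻ ξ, F (update (update z i (T ξ (z i))) j (z j + c ξ (z i))) ∂μ := (hF.comp hJm).lintegral_prod_right'
  rw [← lintegral_indicator hDm, ← lintegral_indicator hDm, volume_pi]
  refine lintegral_eq_of_lmarginal_eq {i, j} (hf₁.indicator hDm) (hF.indicator hDm) ?_
  have hj : j ∉ ({i} : Finset (Fin N)) := by simpa using hij.symm
  rw [Finset.pair_comm, lmarginal_insert' _ (hf₁.indicator hDm) hj, lmarginal_insert' _ (hF.indicator hDm) hj,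
    lmarginal_singleton, lmarginal_singleton]
  funext x
  -- the two coordinates made explicit
  have hind : ∀ (G : Config N d (UnitAddTorus d) → ℝ≥0∞) (a b : UnitAddTorus d × EuclideanSpace ℝ d),
      {z : Config N d (UnitAddTorus d) | z i ∈ D₀}.indicator G (update (update x i a) j b) =
        D₀.indicator (fun a => G (update (update x i a) j b)) a := by
    intro G a b
    have hmem : update (update x i a) j b ∈ {z : Config N d (UnitAddTorus d) | z i ∈ D₀} ↔ a ∈ D₀ := by
      rw [mem_setOf_eq, (update_update_apply hij x a b).1]
    by_cases h : a ∈ D₀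
    · rw [indicator_of_mem h, indicator_of_mem (hmem.2 h)]
    · rw [indicator_of_notMem h, indicator_of_notMem (fun h' => h (hmem.1 h'))]
  have hmap : ∀ (ξ : Ξ) (a b : UnitAddTorus d × EuclideanSpace ℝ d),
      update (update (update (update x i a) j b) i (T ξ ((update (update x i a) j b) i))) j
        ((update (update x i a) j b) j + c ξ ((update (update x i a) j b) i)) =
      update (update x i (T ξ a)) j (b + c ξ a) := by
    intro ξ a b
    rw [(update_update_apply hij x a b).1, (update_update_apply hij x a b).2]
    funext k
    rcases eq_or_ne k j with rfl | hkj
    · simp only [update_self]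
    · rw [update_of_ne hkj, update_of_ne hkj]
      rcases eq_or_ne k i with rfl | hki
      · simp only [update_self]
      · simp only [update_of_ne hki, update_of_ne hkj]
  simp_rw [hind, hmap]
  -- Tonelli in coordinate `j` and the noise, translation invariance in coordinate `j`
  have hU : Measurable fun p : (UnitAddTorus d × EuclideanSpace ℝ d) × (UnitAddTorus d × EuclideanSpace ℝ d) =>
      F (update (update x i p.1) j p.2) :=
    hF.comp (measurable_update'.comp ((measurable_update'.comp (measurable_const.prodMk measurable_fst)).prodMk
      measurable_snd))
  set g : UnitAddTorus d × EuclideanSpace ℝ d → ℝ≥0∞ := fun a => ∫⁻ b, F (update (update x i a) j b) with hg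
  have hgm : Measurable g := hU.lintegral_prod_right'
  have hinner : ∀ a : UnitAddTorus d × EuclideanSpace ℝ d,
      ∫⁻ b, ∫⁻ ξ, F (update (update x i (T ξ a)) j (b + c ξ a)) ∂μ = ∫⁻ ξ, g (T ξ a) ∂μ := by
    intro a
    have hm : Measurable fun p : (UnitAddTorus d × EuclideanSpace ℝ d) × Ξ =>
        F (update (update x i (T p.2 a)) j (p.1 + c p.2 a)) :=
      hU.comp ((hT.comp (measurable_snd.prodMk measurable_const)).prodMk
        (measurable_fst.add (hc.comp (measurable_snd.prodMk measurable_const))))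
    rw [lintegral_lintegral_swap hm.aemeasurable]
    refine lintegral_congr fun ξ => ?_
    rw [hg]
    exact lintegral_add_right_eq_self (fun b => F (update (update x i (T ξ a)) j b)) (c ξ a)
  have hL : ∫⁻ a, D₀.indicator (fun a => ∫⁻ b, ∫⁻ ξ, F (update (update x i (T ξ a)) j (b + c ξ a)) ∂μ) a =
      ∫⁻ a in D₀, ∫⁻ ξ, g (T ξ a) ∂μ := by
    rw [← lintegral_indicator hD₀]
    congr 1
    funext a
    simp only [hinner]
  have hR : ∫⁻ a, D₀.indicator (fun a => ∫⁻ b, F (update (update x i a) j b)) a = ∫⁻ a in D₀, g a := by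
    rw [← lintegral_indicator hD₀]
  -- swap the `b`-integral inside the indicator with the `ξ`-integral: first pull `ξ` out
  have hswap : ∀ a : UnitAddTorus d × EuclideanSpace ℝ d,
      ∫⁻ b, D₀.indicator (fun a => ∫⁻ ξ, F (update (update x i (T ξ a)) j (b + c ξ a)) ∂μ) a =
        D₀.indicator (fun a => ∫⁻ b, ∫⁻ ξ, F (update (update x i (T ξ a)) j (b + c ξ a)) ∂μ) a := by
    intro a
    by_cases ha : a ∈ D₀
    · simp only [indicator_of_mem ha]
    · simp only [indicator_of_notMem ha, lintegral_zero]
  have hswap' : ∀ a : UnitAddTorus d × EuclideanSpace ℝ d,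
      ∫⁻ b, D₀.indicator (fun a => F (update (update x i a) j b)) a =
        D₀.indicator (fun a => ∫⁻ b, F (update (update x i a) j b)) a := by
    intro a
    by_cases ha : a ∈ D₀
    · simp only [indicator_of_mem ha]
    · simp only [indicator_of_notMem ha, lintegral_zero]
  simp_rw [hswap, hswap']
  rw [hL, hR]
  exact hinv g hgm

end Lift


end HalfAngle

end Summit.AtomisticToContinuum.HydrodynamicLimit.Theorems
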